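import Summits.KontsevichZagierPeriods.Zeta5Search.LaiSweepShard

/-!
# `κ₃` sweep certificate — shard file 016 of 127 (shards 112–118 of 889)

HONEST FRAMING. Systematic search; no irrationality claim unless certified. This file only checks,
by `decide +kernel`, shards 112–118 of the order-cell sweep of the `κ₃` point `(74, 2180, 444; δ74)`
(engine `LaiSweepEngine`, soundness `LaiSweepJump/Free/Eval/Shard/Kappa3`; a shard is `⟨regime, n,
p, q, p', q', Lo, Up⟩`: `n` cells from `p/q` to `p'/q'` with integer rate sums in `[Lo, Up]`, `K =
128`, `D = 2^40`). It draws NO conclusion: only the capstone `LaiKappa3SweepCert`, which needs all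
127 shard files, does. Kernel cost of this file ≈ 496 cells × 0.3 s.
-/

namespace Summit.KontsevichZagierPeriods.Zeta5Search.Sweep

set_option maxHeartbeats 100000000 in
/-- Shard 112: 80 cells of regime A from `76/2615` to `13/444`.
[cite: Lai2024BallRivoal, §4 Lemma 4.3] -/
theorem shard112 :
    Shard.check 128 (2^40)
      ⟨false, 80, 76, 2615, 13, 444, 43619407251274, 43641380684974⟩ = true := by
  decide +kernel

set_option maxHeartbeats 100000000 in
/-- Shard 113: 80 cells of regime A from `13/444` to `74/2505`.
[cite: Lai2024BallRivoal, §4 Lemma 4.3] -/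
theorem shard113 :
    Shard.check 128 (2^40)
      ⟨false, 80, 13, 444, 74, 2505, 51693552470391, 51725186032271⟩ = true := by
  decide +kernel

set_option maxHeartbeats 100000000 in
/-- Shard 114: 80 cells of regime A from `74/2505` to `67/2250`.
[cite: Lai2024BallRivoal, §4 Lemma 4.3] -/
theorem shard114 :
    Shard.check 128 (2^40)
      ⟨false, 80, 74, 2505, 67, 2250, 46301729371570, 46325899852441⟩ = true := by
  decide +kernel

set_option maxHeartbeats 100000000 in
/-- Shard 115: 80 cells of regime A from `67/2250` to `33/1099`.
[cite: Lai2024BallRivoal, §4 Lemma 4.3] -/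
theorem shard115 :
    Shard.check 128 (2^40)
      ⟨false, 80, 67, 2250, 33, 1099, 48648745776148, 48674629836327⟩ = true := by
  decide +kernel

set_option maxHeartbeats 100000000 in
/-- Shard 116: 80 cells of regime A from `33/1099` to `17/562`.
[cite: Lai2024BallRivoal, §4 Lemma 4.3] -/
theorem shard116 :
    Shard.check 128 (2^40)
      ⟨false, 80, 33, 1099, 17, 562, 44750925528035, 44774320025295⟩ = true := by
  decide +kernel

set_option maxHeartbeats 100000000 in
/-- Shard 117: 16 cells of regime A from `17/562` to `1/33`.
[cite: Lai2024BallRivoal, §4 Lemma 4.3] -/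
theorem shard117 :
    Shard.check 128 (2^40)
      ⟨false, 16, 17, 562, 1, 33, 10816600741607, 10823438327650⟩ = true := by
  decide +kernel

set_option maxHeartbeats 100000000 in
/-- Shard 118: 80 cells of regime B from `1/33` to `10/317`.
[cite: Lai2024BallRivoal, §4 Lemma 4.3] -/
theorem shard118 :
    Shard.check 128 (2^40)
      ⟨true, 80, 1, 33, 10, 317, 237394694412482, 237684871498925⟩ = true := by
  decide +kernel

/-- The checked shards of this file, in order. [folklore] -/
def shards016 : List (CheckedShard 128 (2^40)) :=
  [⟨_, shard112⟩, ⟨_, shard113⟩, ⟨_, shard114⟩, ⟨_, shard115⟩, ⟨_, shard116⟩,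
    ⟨_, shard117⟩, ⟨_, shard118⟩]

end Summit.KontsevichZagierPeriods.Zeta5Search.Sweep
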